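import Literature.Algebra.Homology.DiscreteRepExtOneLayerDescent
import Literature.Algebra.Homology.DiscreteRepInflationStages
import Literature.Algebra.Homology.DiscreteRepInvariantsQuotient
import HarnessLib

/-!
# The degree-one layer descent `Φ : Ext¹_{C_Γ}(k, V) ≃+ H¹_cont(Γ, V)` COMMUTES WITH INFLATION along `Γ ↠ Γ ⧸ N`
# (Serre, *Galois Cohomology* I §2.2 Prop. 8; Harari §4.3 Remark 4.24)

Topic `Algebra/Homology`; namespace `Literature.Algebra.Homology.DiscreteRep.ExtOneLayer`.  THEOREMS ONLY (one
abbreviation `inflH1` for Mathlib's inflation map on continuous `H¹`); no named fact, no instance, no notation, no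
`sorry`.  Sequel of `DiscreteRepExtOneLayerDescent` (the layer descent `extOneToH1 ρ` for a profinite group, its
cocycle formula and naturality) and of `DiscreteRepInflationStages` (bsd-eis -w6 g11: inflation in stages
`Inf_N (inflG Ū Y c) ≫ incl = inflG (π⁻¹Ū) M (Hⁿ(θ, ψ ≫ incl) c)`).

THE MATHEMATICS.  Let `Γ` be profinite, `N ⊴ Γ` a normal subgroup with `Γ ⧸ N` profinite (e.g. `N` closed), and
`ρ` a continuous representation of `Γ` on a discrete `k`-module `V`; write `V^N` for the `Γ ⧸ N`-module of
`N`-invariants (`ρ.quotientInvariants N`).  On the `Ext` side the inflation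
`Ext¹_{C_{Γ/N}}(k, V^N) → Ext¹_{C_Γ}(k, V)` is `x ↦ Inf_N x ≫ incl` (`DiscreteRep.inflExtHomTriv N` followed by the
counit `invariantsInclQuot N : Inf_N(V^N) ⟶ V`); on the cohomology side it is Mathlib's
`ContinuousCohomology.map (Γ ↠ Γ ⧸ N) (V^N ⊆ V) 1 : H¹_cont(Γ ⧸ N, V^N) → H¹_cont(Γ, V)` (`inflH1`; for
`Γ = Γ_K` this IS the tree's `galoisCohomology.inf`, and for `N = N_S` the tree's `restrictedInf`).
**Theorem (`extOneToH1_inflExtHomTriv_comp_invariantsInclQuot`).**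

  `Φ_V (Inf_N x ≫ incl) = inflH1 (Φ_{V^N} x)`      (`x ∈ Ext¹_{C_{Γ/N}}(k, V^N)`).

Proof: write `x = inflG Ū [γ]` for a layer cocycle `γ ∈ Z¹((Γ⧸N)⧸Ū, (V^N)^Ū)` (`exists_inflG_eq` over `Γ ⧸ N`);
by -w6's `inflExtHomTriv_inflG_comp_mk₀_invariantsInclQuot` the left-hand side is `Φ_V (inflG (π⁻¹Ū) [γ ∘ θ])`,
i.e. the class of the continuous cocycle `σ ↦ γ(σ̄)` of `Γ` (`extOneToH1_inflG_H1π_eq_of_apply`); the right-hand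
side is `inflH1 [σ̄ ↦ γ(σ̄ mod Ū)]` (`extOneToH1_inflG_H1π` over `Γ ⧸ N`), the class of the same cocycle
(`map_oneCocycleClass`).  Also the inverse form `Φ_V⁻¹ (inflH1 y) = Inf_N (Φ_{V^N}⁻¹ y) ≫ incl`
(`extOneEquivH1_symm_inflH1`).

Written for lane «PT-Ш-S-TC» of cell `bsd-eis` (crux `GoodLatticeBDPValue`, brick D4b/F2d step (d): the bridge
`nat_S` at `G_S = Γ_K ⧸ N_S` versus the bridge at `Γ_K` under inflation, in LAYER currency).  HONEST FRAMING:
homological bookkeeping; no arithmetic statement, no case of Poitou–Tate duality or BSD is proved here.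
AI formalisation, weaker than expert review; established only by the kernel check.

## References
* J.-P. Serre, *Galois Cohomology* (1997), I §2.2 Proposition 8 and Corollary 1. [SerreGaloisCohomology1997]
* D. Harari, *Galois Cohomology and Class Field Theory* (2020), §4.3 Remark 4.24, §1.5 (compatible pairs).
  [Harari2020]
* J. Neukirch, A. Schmidt, K. Wingberg, *Cohomology of Number Fields* (2nd ed. 2008), (1.5.1), (1.5.2).
  [NeukirchSchmidtWingberg2008]
-/

noncomputable section

universe u

namespace Literature.Algebra.Homology

namespace DiscreteRep

namespace ExtOneLayer

open CategoryTheory CategoryTheory.Abelian groupCohomology Function Topology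
open Literature.NumberTheory.GaloisRepresentations

variable {k Γ : Type u} [CommRing k] [TopologicalSpace k] [Group Γ] [TopologicalSpace Γ] [IsTopologicalGroup Γ]
  (N : Subgroup Γ) [N.Normal]
  {V : Type u} [AddCommGroup V] [Module k V] [TopologicalSpace V] [DiscreteTopology V] [ContinuousSMul k V]
  (ρ : ContinuousRep Γ k V)

/-! ## §1 The inflation map on continuous `H¹` and the two identifications of the `Γ ⧸ N`-module `V^N` -/

/-- **Mathlib's inflation `inflH1 N ρ : H¹_cont(Γ ⧸ N, V^N) → H¹_cont(Γ, V)`**: pull back along `Γ ↠ Γ ⧸ N`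
(`ContinuousMonoidHom.quotientMk`) and push forward along `V^N ⊆ V` (`ContinuousCohomology.map`).  For
`Γ = Γ_K` this is the tree's `galoisCohomology.inf ρ N 1` (same term). [cite: SerreGaloisCohomology1997, I §2.2]
[cite: NeukirchSchmidtWingberg2008, (1.5.2)] -/
abbrev inflH1 :
    (continuousCohomology 1 (ρ.quotientInvariants N).toTopRep : TopModuleCat k) ⟶
      (continuousCohomology 1 ρ.toTopRep : TopModuleCat k) :=
  ContinuousCohomology.map (ContinuousMonoidHom.quotientMk N)
    (X := (ρ.quotientInvariants N).toTopRep) (Y := ρ.toTopRep) (TopRep.ofHom ⟨Submodule.subtypeL _, fun _ => rfl⟩) 1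

omit [ContinuousSMul k V] in
/-- The object `(V)^N` of `C_{Γ/N}` produced by the functor `invariantsQuotD k N` from `ofContinuousRep ρ` IS
(`rfl`) `ofContinuousRep (ρ.quotientInvariants N)`. [cite: Harari2020, §4.3 Remark 4.24] -/
theorem invariantsQuotD_obj_ofContinuousRep :
    (invariantsQuotD k N).obj (ofContinuousRep ρ) = ofContinuousRep (ρ.quotientInvariants N) := rfl

/-- **`inflH1` on an inflated layer cocycle class**: for a layer cocycle `γ ∈ Z¹((Γ⧸N)⧸Ū, (V^N)^Ū)`,
`inflH1 [σ̄ ↦ γ(σ̄ mod Ū)] = [σ ↦ γ(σ̄ mod Ū)]`. [cite: SerreGaloisCohomology1997, I §2.2 Proposition 8] -/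
theorem inflH1_oneCocycleClass_inflateCocycle (Ū : OpenNormalSubgroup (Γ ⧸ N))
    (γ : cocycles₁ ((invariantsQuotFunctor k (Ū : Subgroup (Γ ⧸ N))).obj
      (ofContinuousRep (ρ.quotientInvariants N)))) :
    (inflH1 N ρ).hom (oneCocycleClass (ρ.quotientInvariants N).toTopRep (inflateCocycle (ρ.quotientInvariants N) Ū γ)) =
      oneCocycleClass ρ.toTopRep
        (contOneCocycles.pullback (ContinuousMonoidHom.quotientMk N)
          (X := (ρ.quotientInvariants N).toTopRep) (Y := ρ.toTopRep) (TopRep.ofHom ⟨Submodule.subtypeL _, fun _ => rfl⟩)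
          (inflateCocycle (ρ.quotientInvariants N) Ū γ)) :=
  map_oneCocycleClass (ContinuousMonoidHom.quotientMk N)
    (X := (ρ.quotientInvariants N).toTopRep) (Y := ρ.toTopRep) (TopRep.ofHom ⟨Submodule.subtypeL _, fun _ => rfl⟩) _

/-! ## §2 `Φ` commutes with inflation -/

section Profinite

variable [CompactSpace Γ] [TotallyDisconnectedSpace Γ] [CompactSpace (Γ ⧸ N)] [TotallyDisconnectedSpace (Γ ⧸ N)]

/-- **On a layer class**: `Φ_V (Inf_N (inflG Ū [γ]) ≫ incl) = inflH1 (Φ_{V^N} (inflG Ū [γ]))` — both sides are the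
class of the continuous cocycle `σ ↦ γ((σ mod N) mod Ū)` of `Γ`. [cite: SerreGaloisCohomology1997, I §2.2 Proposition 8]
[cite: Harari2020, §4.3 Remark 4.24] -/
theorem extOneToH1_inflExtHomTriv_comp_invariantsInclQuot_inflG_H1π (Ū : OpenNormalSubgroup (Γ ⧸ N))
    (γ : cocycles₁ ((invariantsQuotFunctor k (Ū : Subgroup (Γ ⧸ N))).obj
      ((invariantsQuotD k N).obj (ofContinuousRep ρ)))) :
    extOneToH1 ρ
        ((inflExtHomTriv N ((invariantsQuotD k N).obj (ofContinuousRep ρ)) 1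
            (LayerColimit.inflG Ū ((invariantsQuotD k N).obj (ofContinuousRep ρ)) 1 (H1π _ γ))).comp
          (Ext.mk₀ (invariantsInclQuot N (ofContinuousRep ρ))) (add_zero 1)) =
      (inflH1 N ρ).hom (extOneToH1 (ρ.quotientInvariants N)
        (LayerColimit.inflG Ū (ofContinuousRep (ρ.quotientInvariants N)) 1 (H1π _ γ))) := by
  rw [LayerColimit.inflExtHomTriv_inflG_comp_mk₀_invariantsInclQuot N (LayerColimit.stagePreimage N Ū) Ū le_rfl,
    H1π_comp_map_apply]
  -- right-hand side: the inflated layer cocycle of `Γ ⧸ N`, pulled back to `Γ`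
  have hR : extOneToH1 (ρ.quotientInvariants N)
      (LayerColimit.inflG Ū (ofContinuousRep (ρ.quotientInvariants N)) 1 (H1π _ γ)) =
        oneCocycleClass (ρ.quotientInvariants N).toTopRep (inflateCocycle (ρ.quotientInvariants N) Ū γ) :=
    extOneToH1_inflG_H1π (ρ.quotientInvariants N) Ū γ
  rw [hR, inflH1_oneCocycleClass_inflateCocycle]
  -- left-hand side: the layer cocycle `γ ∘ θ` of `Γ ⧸ π⁻¹Ū`, read through `Φ_V`
  exact extOneToH1_inflG_H1π_eq_of_apply ρ (LayerColimit.stagePreimage N Ū) _ _ fun σ => rfl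

/-- **`Φ` COMMUTES WITH INFLATION**: for every `x ∈ Ext¹_{C_{Γ/N}}(k, V^N)`,
`Φ_V (Inf_N x ≫ incl) = inflH1 (Φ_{V^N} x)`. [cite: SerreGaloisCohomology1997, I §2.2 Proposition 8]
[cite: Harari2020, §4.3 Remark 4.24] -/
theorem extOneToH1_inflExtHomTriv_comp_invariantsInclQuot
    (x : Ext (triv (Γ := Γ ⧸ N) k) ((invariantsQuotD k N).obj (ofContinuousRep ρ)) 1) :
    extOneToH1 ρ
        ((inflExtHomTriv N ((invariantsQuotD k N).obj (ofContinuousRep ρ)) 1 x).comp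
          (Ext.mk₀ (invariantsInclQuot N (ofContinuousRep ρ))) (add_zero 1)) =
      (inflH1 N ρ).hom (extOneToH1 (ρ.quotientInvariants N) x) := by
  obtain ⟨Ū, c, rfl⟩ := LayerColimit.exists_inflG_eq 1 ((invariantsQuotD k N).obj (ofContinuousRep ρ)) x
  induction c using H1_induction_on with
  | h γ => exact extOneToH1_inflExtHomTriv_comp_invariantsInclQuot_inflG_H1π N ρ Ū γ

/-- **Inverse form**: `Φ_V⁻¹ (inflH1 y) = Inf_N (Φ_{V^N}⁻¹ y) ≫ incl` for every `y ∈ H¹_cont(Γ ⧸ N, V^N)` — the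
`Ext`-side inflation of the bridge `Φ⁻¹` at `Γ ⧸ N` is the bridge at `Γ` of the inflated class.
[cite: SerreGaloisCohomology1997, I §2.2 Proposition 8][cite: Harari2020, §4.3 Remark 4.24] -/
theorem extOneEquivH1_symm_inflH1 (y : continuousCohomology 1 (ρ.quotientInvariants N).toTopRep) :
    (extOneEquivH1 ρ).symm ((inflH1 N ρ).hom y) =
      (inflExtHomTriv N ((invariantsQuotD k N).obj (ofContinuousRep ρ)) 1
          ((extOneEquivH1 (ρ.quotientInvariants N)).symm y)).comp
        (Ext.mk₀ (invariantsInclQuot N (ofContinuousRep ρ))) (add_zero 1) := by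
  apply (extOneEquivH1 ρ).injective
  rw [AddEquiv.apply_symm_apply, extOneEquivH1_apply, extOneToH1_inflExtHomTriv_comp_invariantsInclQuot,
    ← extOneEquivH1_apply, AddEquiv.apply_symm_apply]

end Profinite

end ExtOneLayer

end DiscreteRep

end Literature.Algebra.Homology

end
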